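import Mathlib
import Literature.Computability.Complexity.RangeAvoidance
import Literature.Computability.Complexity.CodeFPStringKit
import Literature.Computability.Complexity.CodeFPFinite
import Literature.Computability.Complexity.SplitOnesBricks

/-!
# Route Nc03AvoidResidualCore, item `ResidualCoreReduction` — the solver, I: parsing the input code

Helper file for `stmt-PneNP-20227` (residual-core reduction of `NC⁰₃-AVOID` at linear stretch; cell
pnp-ideate). First file of the polynomial-time layer. The solver is written in the typed algebra
`CodeFP` of the tree (`Literature/…/CodeFP*.lean`); its input is the flat string
`LocalMap.encode I = 1ⁿ 0 1ᵐ 0 · (8 table bits · 1^{a_j} 0 · 1^{b_j} 0 · 1^{c_j} 0)_{j<m}`.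
Here we define the structured ("raw") form `RI = (n, m, records)` of an instance, a record being
`(table : Fin 8 → Bool, a, b, c)`, the mathematical map `toRaw`, a total parser `parse` on strings
(unary blocks read by `splitOnes`), prove `parse (encode I) = toRaw I`, and prove that `parse` is
computed on codes in polynomial time (`codeFP_parse`; a fold over a unit budget of length `m`
whose accumulator — the unread suffix and the records read so far — stays linear in the input).
Hence `codeFP_toRaw : CodeFP eIn riE toRaw` on the Σ-type of all instances. [folklore]
-/

set_option linter.dupNamespace false -- `Summit.PneNP.PneNP.…`: summit = sub-problem name (D-0017 single-conjunct layout)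

namespace Summit.PneNP.PneNP.Theorems.Nc03Reduction

open Literature.Computability.Complexity CodeFP

/-! ## Raw instances -/

/-- A record: the table byte of an output (bit `p` = value on the input triple `i ↦ testBit p i`)
and its three variable indices. -/
abbrev Rec := (Fin 8 → Bool) × ℕ × ℕ × ℕ

/-- A raw instance: `n`, `m`, and the records of the outputs. -/
abbrev RI := ℕ × ℕ × List Rec

/-- The code of a table byte: its eight bits. -/
def tabE (T : Fin 8 → Bool) : List Bool := List.ofFn T

/-- The code of a record. -/
def recE : Rec → List Bool := pairE tabE (pairE unE (pairE unE unE))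

/-- The code of a raw instance. -/
def riE : RI → List Bool := pairE unE (pairE unE (rawE recE))

/-- All instances of `NC⁰₃-AVOID`, as one type. -/
abbrev Inst := Σ n m : ℕ, LocalMap 3 n m

/-- The input code of an instance: `LocalMap.encode`. -/
def eIn (x : Inst) : List Bool := x.2.2.encode

/-- The record of output `j`. -/
def recOf {n m : ℕ} (I : LocalMap 3 n m) (j : Fin m) : Rec :=
  (fun p => I.table j (fun i : Fin 3 => p.val.testBit i.val), (I.vars j 0).val, (I.vars j 1).val,
    (I.vars j 2).val)

/-- The raw form of an instance. -/
def toRaw (x : Inst) : RI := (x.1, x.2.1, List.ofFn (recOf x.2.2))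

/-! ## The parser -/

/-- The string of a record inside `encode`. -/
def recStr (r : Rec) : List Bool :=
  List.ofFn r.1 ++ (ones r.2.1 ++ false :: (ones r.2.2.1 ++ false :: (ones r.2.2.2 ++ [false])))

/-- Reading one record off the front of a string. -/
def parseRec (s : List Bool) : Rec × List Bool :=
  ((fun p => s.getD p.val false, (splitOnes (s.drop 8)).1, (splitOnes (splitOnes (s.drop 8)).2).1,
    (splitOnes (splitOnes (splitOnes (s.drop 8)).2).2).1),
    (splitOnes (splitOnes (splitOnes (s.drop 8)).2).2).2)

/-- One step of the body parser: read a record, append it. -/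
def parseStep (_u : Unit) (st : List Bool × List Rec) : List Bool × List Rec :=
  ((parseRec st.1).2, st.2 ++ [(parseRec st.1).1])

/-- The body parser: `m` steps from the body string. -/
def parseBody (p : List Bool × List Unit) : List Bool × List Rec :=
  p.2.foldl (fun st u => parseStep u st) (p.1, [])

/-- The total parser of input codes. -/
def parse (w : List Bool) : RI :=
  ((splitOnes w).1, (splitOnes (splitOnes w).2).1,
    (parseBody ((splitOnes (splitOnes w).2).2, List.replicate (splitOnes (splitOnes w).2).1 ())).2)

/-- `unaryCode a = 1ᵃ 0`. -/
theorem unaryCode_eq (a : ℕ) : LocalMap.unaryCode a = ones a ++ [false] := rfl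

/-- The records of the input code are the record strings. -/
theorem encode_records {n m : ℕ} (I : LocalMap 3 n m) :
    (fun j : Fin m => (List.ofFn fun p : Fin (2 ^ 3) => I.table j (fun i : Fin 3 => p.val.testBit i.val)) ++
      (List.ofFn fun i : Fin 3 => LocalMap.unaryCode (I.vars j i).val).flatten) =
      fun j => recStr (recOf I j) := by
  funext j
  simp only [recStr, recOf, List.ofFn_succ, List.ofFn_zero, List.flatten_cons, List.flatten_nil,
    unaryCode_eq, List.append_nil, List.append_assoc, List.singleton_append, Fin.succ_zero_eq_one,
    Fin.succ_one_eq_two]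

/-- The input code, spelled with record strings. -/
theorem encode_eq {n m : ℕ} (I : LocalMap 3 n m) :
    I.encode = ones n ++ false :: (ones m ++ false :: (List.ofFn fun j => recStr (recOf I j)).flatten) := by
  unfold LocalMap.encode
  rw [encode_records, unaryCode_eq, unaryCode_eq]
  simp only [List.append_assoc, List.cons_append, List.nil_append]

/-- Reading a record string. -/
theorem parseRec_recStr (r : Rec) (s : List Bool) : parseRec (recStr r ++ s) = (r, s) := by
  obtain ⟨T, a, b, c⟩ := r
  have h8 : (List.ofFn T).length = 8 := List.length_ofFn
  have hdrop : (recStr (T, a, b, c) ++ s).drop 8 =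
      ones a ++ false :: (ones b ++ false :: (ones c ++ false :: s)) := by
    rw [recStr, List.append_assoc, List.drop_left' h8]
    simp only [List.append_assoc, List.cons_append, List.nil_append]
  unfold parseRec
  rw [hdrop, splitOnes_ones_append, splitOnes_ones_append, splitOnes_ones_append]
  simp only [Prod.mk.injEq, and_true]
  funext p
  rw [recStr, List.append_assoc, List.getD_eq_getElem?_getD,
    List.getElem?_append_left (by rw [h8]; exact p.isLt), List.getElem?_ofFn]
  simp [p.isLt]

/-- The body parser reads the records one by one. -/
theorem parseBody_flatten (L : List Rec) : ∀ (acc : List Rec) (k : ℕ) (s : List Bool), L.length ≤ k →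
    ((List.replicate L.length ()).foldl (fun st u => parseStep u st) ((L.map recStr).flatten ++ s, acc)) =
      (s, acc ++ L) := by
  induction L with
  | nil => intro acc k s _; simp
  | cons r L ih =>
    intro acc k s hk
    rw [List.length_cons, List.replicate_succ, List.foldl_cons, List.map_cons, List.flatten_cons,
      List.append_assoc]
    have hstep : parseStep () (recStr r ++ ((L.map recStr).flatten ++ s), acc) =
        ((L.map recStr).flatten ++ s, acc ++ [r]) := by
      unfold parseStep; rw [parseRec_recStr]
    rw [hstep, ih (acc ++ [r]) k s (by simp at hk; omega), List.append_assoc, List.singleton_append]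

/-- **The parser inverts the input code.** -/
theorem parse_encode (x : Inst) : parse (eIn x) = toRaw x := by
  obtain ⟨n, m, I⟩ := x
  unfold parse eIn toRaw
  simp only [encode_eq, splitOnes_ones_append]
  refine Prod.ext rfl (Prod.ext rfl ?_)
  have h := parseBody_flatten (List.ofFn (recOf I)) [] m [] (by simp)
  simp only [List.append_nil, List.nil_append, List.length_ofFn, List.map_ofFn] at h
  unfold parseBody
  simp only
  rw [show (fun j => recStr (recOf I j)) = recStr ∘ recOf I from rfl, h]

/-! ## The parser is polynomial time -/

/-- The leading unary block, as a unary numeral. -/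
theorem codeFP_blockFst : CodeFP strE unE (fun s => (splitOnes s).1) :=
  of_fn onesPrefixFn onesPrefixFn_mem_FP fun s => by
    rw [unE_eq_ones]; rfl

/-- The string after the leading unary block. -/
theorem codeFP_blockSnd : CodeFP strE strE (fun s => (splitOnes s).2) :=
  of_fn afterZeroFn afterZeroFn_mem_FP fun _ => rfl

/-- The table byte at the front of a string: its code is the 8-prefix of the padded string. -/
theorem tabE_front (s : List Bool) :
    tabE (fun p : Fin 8 => s.getD p.val false) = (s ++ List.replicate 8 false).take 8 := by
  unfold tabE
  apply List.ext_getElem?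
  intro i
  rw [List.getElem?_ofFn, List.getElem?_take]
  by_cases hi : i < 8
  · simp only [hi, dite_true, if_true]
    rw [List.getD_eq_getElem?_getD]
    by_cases his : i < s.length
    · rw [List.getElem?_append_left his, List.getElem?_eq_getElem his]; rfl
    · rw [List.getElem?_append_right (by omega), List.getElem?_eq_none (by omega),
        List.getElem?_replicate]
      simp only [Option.getD_none]
      rw [if_pos (by omega)]
  · simp [hi]

/-- Reading the table byte at the front. -/
theorem codeFP_front : CodeFP strE tabE (fun s => fun p : Fin 8 => s.getD p.val false) :=
  (strTake.comp ((const strE 8).pair (strAppend.comp ((CodeFP.id strE).pair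
    (const strE (List.replicate 8 false)))))).recodeOut fun s => by
    simp only [id]; rw [tabE_front]

/-- Reading one record is polynomial time. -/
theorem codeFP_parseRec : CodeFP strE (pairE recE strE) parseRec := by
  have hd : CodeFP strE strE (fun s => s.drop 8) := strDrop.comp ((const strE 8).pair (CodeFP.id strE))
  have h1 := codeFP_blockFst.comp hd
  have h1' := codeFP_blockSnd.comp hd
  have h2 := codeFP_blockFst.comp h1'
  have h2' := codeFP_blockSnd.comp h1'
  have h3 := codeFP_blockFst.comp h2'
  have h3' := codeFP_blockSnd.comp h2'
  exact (codeFP_front.pair (h1.pair (h2.pair h3))).pair h3'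

/-- Length of a record code in terms of the record string. -/
theorem length_recE_le (r : Rec) : (recE r).length ≤ 2 * (recStr r).length + 8 := by
  obtain ⟨T, a, b, c⟩ := r
  simp only [recE, pairE_apply, length_boolPair, tabE, List.length_ofFn, length_unE, recStr,
    List.length_append, List.length_cons, ones, List.length_replicate, List.length_nil]
  omega

/-- The parser step is polynomial time (as a step with a unit item and a string context). -/
theorem codeFP_parseStep : CodeFP (pairE strE (pairE unitE (pairE strE (rawE recE))))
    (pairE strE (rawE recE)) (fun t => parseStep t.2.1 t.2.2) := by
  have hst : CodeFP (pairE strE (pairE unitE (pairE strE (rawE recE)))) (pairE strE (rawE recE))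
      (fun t => t.2.2) := (snd _ _).snd'
  have hrec := codeFP_parseRec.comp hst.fst'
  refine (hrec.snd'.pair ((rawAppend recE).comp (hst.snd'.pair ((rawSingleton recE).comp hrec.fst')))).congr ?_
  intro t; rfl

/-- Along the run of the body parser on a genuine body, the state is a suffix of the body and a
prefix of the record list. -/
theorem parseBody_prefix (L : List Rec) (s : List Bool) (k : ℕ) (hk : k ≤ L.length) :
    (List.replicate k ()).foldl (fun st u => parseStep u st) ((L.map recStr).flatten ++ s, ([] : List Rec)) =
      (((L.drop k).map recStr).flatten ++ s, L.take k) := by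
  have h := parseBody_flatten (L.take k) [] k (((L.drop k).map recStr).flatten ++ s) (by simp)
  rw [List.length_take, min_eq_left hk, List.nil_append, ← List.append_assoc, ← List.flatten_append,
    ← List.map_append, List.take_append_drop] at h
  exact h

/-- Size accounting for one record: the rest and the three unary values fit in the string. -/
theorem parseRec_le (s : List Bool) :
    (parseRec s).2.length + ((parseRec s).1.2.1 + (parseRec s).1.2.2.1 + (parseRec s).1.2.2.2) ≤
      s.length := by
  unfold parseRec
  simp only
  have h0 : (s.drop 8).length ≤ s.length := by rw [List.length_drop]; omega
  have h1 := splitOnes_le (s.drop 8)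
  have h2 := splitOnes_le (splitOnes (s.drop 8)).2
  have h3 := splitOnes_le (splitOnes (splitOnes (s.drop 8)).2).2
  omega

/-- The weight of a record list: the sum of the unary values. -/
def recWt (L : List Rec) : ℕ := (L.map fun r => r.2.1 + r.2.2.1 + r.2.2.2).sum

/-- Size accounting along the body parser, on any string. -/
theorem parse_fold_le (l : List Unit) : ∀ (s : List Bool) (acc : List Rec),
    (l.foldl (fun st u => parseStep u st) (s, acc)).1.length +
        recWt (l.foldl (fun st u => parseStep u st) (s, acc)).2 ≤ s.length + recWt acc ∧
      (l.foldl (fun st u => parseStep u st) (s, acc)).2.length = acc.length + l.length := by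
  induction l with
  | nil => intro s acc; simp
  | cons u l ih =>
    intro s acc
    rw [List.foldl_cons]
    have hst : parseStep u (s, acc) = ((parseRec s).2, acc ++ [(parseRec s).1]) := rfl
    rw [hst]
    obtain ⟨h1, h2⟩ := ih (parseRec s).2 (acc ++ [(parseRec s).1])
    have h3 := parseRec_le s
    have hw : recWt (acc ++ [(parseRec s).1]) =
        recWt acc + ((parseRec s).1.2.1 + (parseRec s).1.2.2.1 + (parseRec s).1.2.2.2) := by
      simp [recWt]
    refine ⟨?_, ?_⟩
    · rw [hw] at h1; omega
    · rw [h2, List.length_append, List.length_singleton, List.length_cons]; omega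

/-- The code of a record list is linear in its weight and length. -/
theorem length_rawE_recE_le (L : List Rec) : (rawE recE L).length ≤ 4 * recWt L + 50 * L.length := by
  induction L with
  | nil => simp [rawE_nil]
  | cons r L ih =>
    obtain ⟨T, a, b, c⟩ := r
    rw [rawE_cons, length_boolPair]
    simp only [recE, pairE_apply, length_boolPair, tabE, List.length_ofFn, length_unE, recWt,
      List.map_cons, List.sum_cons, List.length_cons] at ih ⊢
    omega

/-- The body parser is polynomial time. -/
theorem codeFP_parseBody : CodeFP (pairE strE (rawE unitE)) (pairE strE (rawE recE)) parseBody := by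
  have h := CodeFP.foldl (σ := List Bool) (α := Unit) (β := List Bool × List Rec) (eσ := strE)
    (eα := unitE) (eβ := pairE strE (rawE recE)) (step := fun _ u st => parseStep u st)
    (init := fun s => (s, [])) codeFP_parseStep ((CodeFP.id strE).pair (const strE ([] : List Rec)))
    (25 * Polynomial.X + 2) (fun s l₁ l₂ => by
      obtain ⟨h1, h2⟩ := parse_fold_le l₁ s []
      have h3 := length_rawE_recE_le (l₁.foldl (fun st u => parseStep u st) (s, [])).2
      have h0 : recWt ([] : List Rec) = 0 := rfl
      rw [h0, add_zero] at h1
      rw [List.length_nil, zero_add] at h2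
      have hu : ∀ l : List Unit, (rawE unitE l).length = 2 * l.length := by
        intro l; induction l with
        | nil => simp [rawE_nil]
        | cons a l ih => rw [rawE_cons, length_boolPair, ih]; simp [unitE]; ring
      simp only [pairE_apply, length_boolPair, Polynomial.eval_add, Polynomial.eval_mul,
        Polynomial.eval_ofNat, Polynomial.eval_X, hu, List.length_append, strE, id]
      change 2 * (l₁.foldl (fun st u => parseStep u st) (s, [])).1.length + 2 +
          (rawE recE (l₁.foldl (fun st u => parseStep u st) (s, [])).2).length ≤
        25 * (2 * s.length + 2 + 2 * (l₁.length + l₂.length)) + 2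
      omega)
  exact h

/-- The unit budget of the body parser. -/
theorem codeFP_units : CodeFP unE (rawE unitE) (fun m => List.replicate m ()) :=
  (unitsPow 1).congr fun n => by rw [pow_one]

/-- **The parser is polynomial time.** -/
theorem codeFP_parse : CodeFP strE riE parse := by
  have hn := codeFP_blockFst
  have hw1 := codeFP_blockSnd
  have hm := codeFP_blockFst.comp hw1
  have hbody := codeFP_blockSnd.comp hw1
  have hrecs := (codeFP_parseBody.comp (hbody.pair (codeFP_units.comp hm))).snd'
  exact hn.pair (hm.pair hrecs)

/-- **The raw form of an instance is computed from its input code in polynomial time.** -/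
theorem codeFP_toRaw : CodeFP eIn riE toRaw := by
  obtain ⟨f, hf, hfs⟩ := codeFP_parse
  exact of_fn f hf fun x => by rw [← parse_encode]; exact hfs (eIn x)

end Summit.PneNP.PneNP.Theorems.Nc03Reduction
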